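import Summits.BirchSwinnertonDyer.BirchSwinnertonDyer.Theorems.PrintX10bHowardRoad
import Literature.NumberTheory.EllipticCurves.CastellaGrossiLeeSkinner2022.HowardDivisibilityAnyClassNumber
import Literature.NumberTheory.EllipticCurves.CastellaGrossiLeeSkinner2022.StabilizedHeegnerDataOfTowerProofs
import Literature.NumberTheory.EllipticCurves.CastellaGrossiSkinner2025.HeegnerKolyvaginBoundAnyClassNumber
import HarnessLib

/-!
# Crux stmt-BirchSwinnertonDyer-23729 `PrintX10b.HowardContainmentAnyClassNumberX10b` (A₃, r303),
# line `torsion-depth-x10b` — the hypotheses of CGLS 2022 Thm. 4.1.3 HOLD on odd-`d_K` X10b Heegner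
# frames (p = 3), in the kernel; and the localized containment in the STABILIZED currency modulo the
# cite-only fact

HONEST FRAMING (seat `bsd-line-x10b-p2`, LEAD on the registered line `torsion-depth-x10b`, skeleton
`Cruxes/HowardContainmentAnyClassNumberX10b/Lines/torsion_depth_x10b.lean` sha16 `cf94ebb465a831ad`):
THEOREMS ONLY (no definition, no named fact, no `sorry`), helpers `--supports` the crux; nothing is closed.
The crux is NOT proved; BSD is not proved by any of this.

WHAT.
* `X10.noPTorsion_baseChange_of_classX10` — (h1) of Castella–Grossi–Lee–Skinner 2022 §3.2 at `p = 3`: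
  on class X10b (`ClassX10 W p`: `p = 3`, good ordinary, `E[3]` irreducible) the base change of `E` to ANY
  quadratic field `K` has no `K`-rational `p`-torsion — `E[p]` irreducible over `ℚ` has no `G_K`-fixed line
  over a quadratic `K` (the tree's `torsionBy_eq_bot_of_hasIrreducibleModPGaloisRep`). UNCONDITIONAL; it is
  the one hypothesis of Thm. 4.1.3 that is not a binder of the crux (referee g4 flag on 23729, 02:58Z).
* `X10.thm413Hypotheses_of_classX10` — the full hypothesis record
  `CastellaGrossiLeeSkinner2022.Thm413Hypotheses (W.conductorNorm ℤ) W K p κ γ` on an odd-`d_K` X10b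
  Heegner frame (`3 ∤ d_K` from `3` split, `not_dvd_discr_of_split`). UNCONDITIONAL. (Verbatim the
  skeleton's in-file reduction, landed so that Theorems-side consumers can cite it.)
* `X10.localizedStabilizedContainment_of_thm413` — for EVERY `Λ`-adic Selmer datum `D`, EVERY CGLS
  `d(k)`-shifted stabilized Heegner datum `C` and EVERY Selmer dual `X` on such a frame there are `m n` with
  `(3^m · T^n) · I(Λκ_C)² ⊆ char_Λ(X_{Λ-tors})` — Thm. 4.1.3 (i)–(ii) in containment form, CONDITIONAL on
  the cite-only fact `thm413_rankOne_charIdeal_torsion_dvd_localized` (gate: `proof.conditional`). This is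
  the by-name content of the line's regime `δ > 0, odd d_K, localized` in the STABILIZED currency; the
  passage to the tree family's `heegnerCharIdeal D F` (skeleton stub `stub_depthPos_localized_oddDisc`)
  additionally needs the envelope comparison `ℋ_F ⊆ Λκ_C`, and inhabiting `C` needs the tower
  containment `K_k ⊆ K[p^{d(k)}]` (PrintX9 item `AnticyclotomicTowerInRingClassFields`) — neither is
  claimed here.

References: [CastellaGrossiLeeSkinner2022] Invent. Math. 227 (2022), §3.2 standing hypotheses (h1),
Thm. 4.1.3, Rem. 4.1.4 (arXiv:2008.02571v2); [GrossLMS1991] Lemma 4.3 (no rational `p`-torsion over `K`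
under irreducibility); [MatarNekovar2019] Prop. 5.26 (2).
-/

set_option linter.dupNamespace false
set_option autoImplicit false

noncomputable section

open scoped Classical

namespace Summit.BirchSwinnertonDyer.BirchSwinnertonDyer.Rank1Residual

open WeierstrassCurve NumberField Literature.NumberTheory.EllipticCurves
  Literature.NumberTheory.EllipticCurves.ModularForms
  Literature.NumberTheory.EllipticCurves.CastellaGrossiLeeSkinner2022
open Literature.NumberTheory.EllipticCurves.Rank1Residual (ClassX10 Surj not_dvd_discr_of_split)

universe u

/-- **(h1) at `p = 3` on class X10b, UNCONDITIONAL:** for `W` in class X10b (`ClassX10 W p`, so `p = 3`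
and `E[3]` is irreducible over `ℚ`) and ANY quadratic number field `K`, `E(K)` has no point of order `p`:
`p • Q = 0 → Q = 0`. An irreducible `E[p]` has no `G_K`-stable line for `[K : ℚ] = 2` (else the line and
its conjugate would make `ρ̄` reducible over `ℚ`), so `E(K)[p] = 0` — the tree theorem
`torsionBy_eq_bot_of_hasIrreducibleModPGaloisRep`. This is hypothesis (h1) "`E(K)[p] = 0`" of
Castella–Grossi–Lee–Skinner 2022 §3.2, the one hypothesis of their Thm. 4.1.3 that is not a binder of
crux 23729. [cite: CastellaGrossiLeeSkinner2022, §3.2 standing hypothesis (h1)] [cite: GrossLMS1991, Lemma 4.3] -/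
theorem X10.noPTorsion_baseChange_of_classX10 {W : WeierstrassCurve ℚ} [W.IsElliptic]
    [W.IsGloballyMinimal] {p : ℕ} [Fact p.Prime] (hX : ClassX10 W p)
    {K : Type u} [Field K] [NumberField K] (hK2 : Module.finrank ℚ K = 2)
    (Q : (W.baseChange K).toAffine.Point) (hQ : p • Q = 0) : Q = 0 := by
  have hbot := torsionBy_eq_bot_of_hasIrreducibleModPGaloisRep W K hK2 (Fact.out : p.Prime) hX.irr
  have hmem : Q ∈ AddSubgroup.torsionBy (W.baseChange K).toAffine.Point (p : ℤ) :=
    AddSubgroup.torsionBy.nsmul_iff.mpr hQ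
  rw [hbot, AddSubgroup.mem_bot] at hmem
  exact hmem

/-- **The hypotheses of CGLS 2022 Thm. 4.1.3 hold on odd-`d_K` X10b Heegner frames — IN THE KERNEL,
UNCONDITIONALLY:** `E` elliptic of conductor `N = N_E`, `p = 3 ≠ 2` good ordinary (`ClassX10`), `K`
imaginary quadratic with `3 ∤ d_K` (`3` split: `not_dvd_discr_of_split`), (h1) `E(K)[3] = 0`
(`X10.noPTorsion_baseChange_of_classX10`), (Heeg), (disc) = `d_K` odd and `≠ -3`, `κ` anticyclotomic
with topological generator `γ`. No class-number, image-size, rank or `Ш` hypothesis enters.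
[cite: CastellaGrossiLeeSkinner2022, §3.2 and §4.1 standing hypotheses (arXiv:2008.02571v2 TeX L1253–1260, L2186)] -/
theorem X10.thm413Hypotheses_of_classX10 {W : WeierstrassCurve ℚ} [W.IsElliptic] [W.IsGloballyMinimal]
    {p : ℕ} [Fact p.Prime] {K : Type} [Field K] [NumberField K]
    (hX : ClassX10 W p) (hK : IsImaginaryQuadratic K) (h3 : NumberField.discr K ≠ -3)
    (hHN : SatisfiesHeegnerHypothesis (W.conductorNorm ℤ) K) (hHp : SatisfiesHeegnerHypothesis p K)
    (hodd : Odd (NumberField.discr K)) {κ : ZpExtension K p} (hκ : κ.IsAnticyclotomic)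
    {γ : Field.absoluteGaloisGroup K} (hγ : κ.IsTopGenerator γ) :
    Thm413Hypotheses (W.conductorNorm ℤ) W K p κ γ where
  isElliptic := inferInstance
  level := rfl
  p_ne_two := hX.ne_two
  ordinary := hX.isOrdinaryAt
  isImaginaryQuadratic := hK
  not_dvd_discr := not_dvd_discr_of_split hK Fact.out hX.ne_two hHp
  noPTorsion := X10.noPTorsion_baseChange_of_classX10 hX hK.1
  heegner := hHN
  discr_odd := hodd
  discr_ne := h3
  anticyclotomic := hκ
  topGenerator := hγ

/-- **CGLS 2022 Thm. 4.1.3 (i)–(ii) on odd-`d_K` X10b Heegner frames, containment form in the STABILIZED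
currency, CONDITIONAL on the cite-only fact `h413`:** for every `Λ`-adic Selmer datum `D` (`H¹_{𝓕_Λ}(K,𝐓)`),
every `d(k)`-shifted `α`-stabilized Heegner datum `C` (Rem. 4.1.4's `Λκ_∞ = Λκ₁^{Hg}`) and every Selmer
dual `X` (`𝒳`) there are `m n : ℕ` with `(p^m · T^n) · I(Λκ_∞)² ⊆ char_Λ(𝒳_{Λ-tors})`, `T = γ - 1` —
Howard's containment with `3` and `γ - 1` inverted, ANY class number of `K`, ANY torsion depth, NO
Galois-image hypothesis beyond (h1) (a theorem here). The hypotheses are discharged by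
`X10.thm413Hypotheses_of_classX10`; the conclusion is `charIdeal_torsion_dvd_localized_of_thm413` read as
an inclusion (`Ideal.le_of_dvd`). Not the crux: the crux speaks of the tree family's `heegnerCharIdeal D F`
and of the INTEGRAL containment. [cite: CastellaGrossiLeeSkinner2022, Thm. 4.1.3 (i)–(ii) and Rem. 4.1.4 (arXiv:2008.02571v2 TeX L2253–2294)] -/
theorem X10.localizedStabilizedContainment_of_thm413
    (h413 : thm413_rankOne_charIdeal_torsion_dvd_localized.{0})
    {W : WeierstrassCurve ℚ} [W.IsElliptic] [W.IsGloballyMinimal] [NeZero (W.conductorNorm ℤ)]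
    {p : ℕ} [Fact p.Prime] {K : Type} [Field K] [NumberField K]
    (hX : ClassX10 W p) (hK : IsImaginaryQuadratic K) (h3 : NumberField.discr K ≠ -3)
    (hHN : SatisfiesHeegnerHypothesis (W.conductorNorm ℤ) K) (hHp : SatisfiesHeegnerHypothesis p K)
    (hodd : Odd (NumberField.discr K)) {κ : ZpExtension K p} (hκ : κ.IsAnticyclotomic)
    {γ : Field.absoluteGaloisGroup K} (hγ : κ.IsTopGenerator γ) {jbar : AlgebraicClosure K →+* ℂ}
    (D : (W.baseChange K).LambdaAdicSelmerData κ γ)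
    (C : StabilizedHeegnerData (W.conductorNorm ℤ) W K κ jbar) (X : (W.baseChange K).SelmerDualData κ γ) :
    ∃ m n : ℕ,
      Ideal.span {((p : IwasawaAlgebra p) ^ m * (PowerSeries.X : IwasawaAlgebra p) ^ n)} *
          stabilizedHeegnerCharIdeal D C ^ 2 ≤
        Module.charIdeal (IwasawaAlgebra p) (Submodule.torsion (IwasawaAlgebra p) X.X) := by
  obtain ⟨m, n, hdvd⟩ := charIdeal_torsion_dvd_localized_of_thm413 h413
    (X10.thm413Hypotheses_of_classX10 hX hK h3 hHN hHp hodd hκ hγ) D C X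
  refine ⟨m, n, ?_⟩
  rw [← Ideal.span_singleton_mul_span_singleton]
  exact Ideal.le_of_dvd hdvd


/-! ### Appended (x10b-p2 LEAD, after plan g9 FINDING PIN-1 / RULING R1–R3, 2026-08-28): the PINNED
`3 ∤ h_K` regime — the Heegner family is built ON THE FRAME'S datum (`F.Dt = Dt`, `F.β = H.β`), so the
rescaling `F ↦ p^a • F` (tree `HeegnerFamilyScalingProofs`) is no longer available to absorb a power of `p`. -/

/-- **Tied Heegner families exist** (the witness of `nonempty_heegnerFamily_of`, with its datum exposed):
under the Heegner hypothesis with `p ∤ N`, for the GIVEN parametrisation datum `Dt`, orientation `β` and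
embedding `jbar` there is a Heegner family `F` along `κ` with `F.Dt = Dt` and `F.β = β` (`y` of conductor
`1`, `z j` of conductor `p^{j+1}`, from the PROVED `exists_isHeegnerNormPoint_holds`). Plan g9 PIN-1 (T4)
shape; stated here for the cell's X10b consumers. [cite: Howard2004HeegnerKolyvagin, §2.7 and §3.3] -/
theorem X10.exists_heegnerFamily_dt_eq {N : ℕ} [NeZero N] {W : WeierstrassCurve ℚ} [W.IsElliptic]
    {K : Type} [Field K] [NumberField K] {p : ℕ} [Fact p.Prime]
    (hK : IsImaginaryQuadratic K) (hH : SatisfiesHeegnerHypothesis N K) (hp : ¬ p ∣ N)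
    (κ : ZpExtension K p) (Dt : ModularParametrizationData W N) {β : ℤ}
    (hβ : (4 * N : ℤ) ∣ β ^ 2 - NumberField.discr K) (jbar : AlgebraicClosure K →+* ℂ) :
    ∃ F : HeegnerFamily N W K κ jbar, F.Dt = Dt ∧ F.β = β := by
  have h := exists_isHeegnerNormPoint_holds N W K p
  have hc : ∀ j : ℕ, (p ^ (j + 1)).Coprime N := fun j ↦
    Nat.Coprime.pow_left _ ((Fact.out : p.Prime).coprime_iff_not_dvd.mpr hp)
  choose z hz using fun j : ℕ ↦ h hK hH κ Dt hβ jbar j (hc j)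
  obtain ⟨y, hy⟩ := h hK hH κ Dt hβ jbar 0 (Nat.coprime_one_left N)
  exact ⟨⟨Dt, β, hβ, y, hy, z, hz⟩, rfl, rfl⟩

/-- **Howard's containment on X10b Heegner frames with `3 ∤ h_K`, PINNED to the frame's parametrisation
datum and orientation** (plan g9 RULING R1: `F.Dt = Dt`, `F.β = H.β`), CONDITIONAL on the cite-only fact
Mastella–Zerman 2026 Cor. 4.6 (`h46`, printed for every odd `p`; scalars `1 + 3ℤ₃` in the image by
Lombardo–Tronto Prop. 3.12, a theorem: `ClassX10.mz26Hypotheses_of_not_surj`): for a non-CM X10b pair, `K`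
imaginary quadratic Heegner for `N_E` and for `3`, `d_K ∉ {−3, −4}`, `3 ∤ h_K`, any anticyclotomic datum
`(κ, γ)`, the GIVEN `Dt`, `H`, and ANY embedding `jbar`, there are `Λ`-adic Selmer data `D`, a Heegner family
`F` with `F.Dt = Dt ∧ F.β = H.β`, and a Selmer dual `X` with `I(ℋ_F)² ⊆ char_Λ(𝒳_{Λ-tors})`. MZ26's fact is
universal in `F`, so the pin costs nothing here; it matters for what CONSUMES the containment (PIN-1 §3).
The by-name close of regime s1 of the pinned restatement `HowardContainmentAnyClassNumberX10bPinned[OfPrint]`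
(PrintX10b rev 20, planned). [cite: MastellaZerman2026, Cor. 4.6, Assumptions 2.1 and 2.13 (v)]
[cite: LombardoTronto2022, Prop. 3.12] [cite: Howard2004HeegnerKolyvagin, Thm. B] -/
theorem X10.heegnerContainmentPinned_of_cor46_of_not_surj
    (h46 : MastellaZerman2026.cor46_howardDivisibility_of_scalarImage.{0})
    {W : WeierstrassCurve ℚ} [W.IsElliptic] [W.IsGloballyMinimal] [NeZero (W.conductorNorm ℤ)]
    {p : ℕ} [Fact p.Prime] (hX : ClassX10 W p) (hns : ¬ Surj W 3) (hcm : ¬ W.HasCM)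
    {K : Type} [Field K] [NumberField K]
    (hK : IsImaginaryQuadratic K) (h3 : NumberField.discr K ≠ -3) (h4 : NumberField.discr K ≠ -4)
    (hHN : SatisfiesHeegnerHypothesis (W.conductorNorm ℤ) K) (hHp : SatisfiesHeegnerHypothesis p K)
    (hhK : ¬ p ∣ NumberField.classNumber K)
    (κ : ZpExtension K p) (hκ : κ.IsAnticyclotomic)
    (γ : Field.absoluteGaloisGroup K) (hγ : κ.IsTopGenerator γ)
    (Dt : ModularParametrizationData W (W.conductorNorm ℤ)) (H : HeegnerDatum (W.conductorNorm ℤ)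
      (NumberField.discr K)) (jbar : AlgebraicClosure K →+* ℂ) :
    ∃ (D : (W.baseChange K).LambdaAdicSelmerData κ γ)
      (F : HeegnerFamily (W.conductorNorm ℤ) W K κ jbar) (X : (W.baseChange K).SelmerDualData κ γ),
      F.Dt = Dt ∧ F.β = H.β ∧
      heegnerCharIdeal D F ^ 2 ≤
        Module.charIdeal (IwasawaAlgebra p) (Submodule.torsion (IwasawaAlgebra p) X.X) := by
  obtain ⟨D⟩ := LambdaAdicSelmerDataExists.nonempty_lambdaAdicSelmerData (W.baseChange K) p κ hγ
  obtain ⟨X⟩ := (W.baseChange K).nonempty_selmerDualData_holds κ γ hγ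
  obtain ⟨F, hFD, hFβ⟩ := X10.exists_heegnerFamily_dt_eq hK hHN hX.not_dvd_conductorNorm κ Dt
    H.dvd_sq_sub jbar
  exact ⟨D, F, X, hFD, hFβ, Ideal.le_of_dvd (MastellaZerman2026.conclusion_of_cor46 (jbar := jbar) h46
    (hX.mz26Hypotheses_of_not_surj hns hcm κ γ hK ⟨h3, h4⟩ hHN hHp hhK hκ hγ) D F X)⟩


/-! ### Appended (x10b-p2 LEAD g2, 2026-08-28): the `3`-LOCALIZED regime at EVERY Selmer corank and EVERY class
number, from Castella–Grossi–Skinner 2025 Thm. 6.5.2 typed at any class number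
(`CastellaGrossiSkinner2025.thm652_stabilized_rankOne_charIdeal_torsion_dvd_pLocalized`, p610515): the `(γ - 1)`-power of
CGLS 2022 Thm. 4.1.3 (ii) is gone WITHOUT the corank-one "Moreover" clause — which crux 23729, having no rank /
`Ш` binder, cannot invoke. -/

/-- **CGS 2025 Thm. 6.5.2 on odd-`d_K` X10b Heegner frames, containment form in the STABILIZED currency, ANY class
number, ANY Selmer corank, CONDITIONAL on the cite-only fact `h652`:** for every `Λ`-adic Selmer datum `D`, every
`d(k)`-shifted `α`-stabilized Heegner datum `C` and every Selmer dual `X` there is `m : ℕ` with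
`(p^m) · I(Λκ_∞)² ⊆ char_Λ(𝒳_{Λ-tors})` — Howard's containment with ONLY `3` inverted (no `γ - 1`), NO Galois-image
hypothesis beyond (h1) (a theorem here: `X10.thm413Hypotheses_of_classX10`), NO rank hypothesis. Compare
`X10.localizedStabilizedContainment_of_thm413` above (`3^m · T^n`). Not the crux: the crux speaks of the tree
family's `heegnerCharIdeal D F` and of the INTEGRAL containment; what remains between this theorem and the crux on
odd-`d_K` frames is the envelope `ℋ_F` vs `Λκ_∞(C)` and the `μ`-part at `3 ∣ h_K`.
[cite: CastellaGrossiSkinner2025, Thm. 6.5.2 (final TeX l.3229–3238) with §6 standing hypotheses (l.2259–2262)]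
[cite: CastellaGrossiLeeSkinner2022, Thm. 4.1.1 and Rem. 4.1.4 (the class κ^{Hg} at any class number)] -/
theorem X10.pLocalizedStabilizedContainment_of_thm652
    (h652 : CastellaGrossiSkinner2025.thm652_stabilized_rankOne_charIdeal_torsion_dvd_pLocalized.{0})
    {W : WeierstrassCurve ℚ} [W.IsElliptic] [W.IsGloballyMinimal] [NeZero (W.conductorNorm ℤ)]
    {p : ℕ} [Fact p.Prime] {K : Type} [Field K] [NumberField K]
    (hX : ClassX10 W p) (hK : IsImaginaryQuadratic K) (h3 : NumberField.discr K ≠ -3)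
    (hHN : SatisfiesHeegnerHypothesis (W.conductorNorm ℤ) K) (hHp : SatisfiesHeegnerHypothesis p K)
    (hodd : Odd (NumberField.discr K)) {κ : ZpExtension K p} (hκ : κ.IsAnticyclotomic)
    {γ : Field.absoluteGaloisGroup K} (hγ : κ.IsTopGenerator γ) {jbar : AlgebraicClosure K →+* ℂ}
    (D : (W.baseChange K).LambdaAdicSelmerData κ γ)
    (C : StabilizedHeegnerData (W.conductorNorm ℤ) W K κ jbar) (X : (W.baseChange K).SelmerDualData κ γ) :
    ∃ m : ℕ,
      Ideal.span {((p : IwasawaAlgebra p) ^ m)} * stabilizedHeegnerCharIdeal D C ^ 2 ≤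
        Module.charIdeal (IwasawaAlgebra p) (Submodule.torsion (IwasawaAlgebra p) X.X) := by
  obtain ⟨-, -, -, J, m, hJ, hdvd⟩ := h652 (W.conductorNorm ℤ) W K p κ γ jbar
    (X10.thm413Hypotheses_of_classX10 hX hK h3 hHN hHp hodd hκ hγ) D C X
  refine ⟨m * 2, Ideal.le_of_dvd ?_⟩
  have h2 := pow_dvd_pow_of_dvd hdvd 2
  rw [mul_pow, Ideal.span_singleton_pow, ← pow_mul] at h2
  rwa [hJ]

/-- **The `3`-localized Howard containment on EVERY odd-`d_K` X10b Heegner frame, for a stabilized datum TIED to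
the frame (`C.Dt = Dt`, `C.β = H.β`), ANY class number, ANY corank** — CONDITIONAL on two cite-only facts: CGS 2025
Thm. 6.5.2 at any class number (`h652`) and the tower containment `K_k ⊆ K[3^{d(k)}]` at this `(K, κ, jbar)` (`hTw`,
the body of PrintX9's support `AnticyclotomicTowerInRingClassFields` instantiated; class field theory). The data
`D`, `X` exist by the PROVED existence theorems; `C` on the frame's datum by the route-free constructor
`StabilizedHeegnerData.exists_of_tower` (p608385). This is the whole PRINT content of crux 23729's `3 ∣ h_K`,
odd-`d_K` regime in the stabilized currency: between it and the crux stand exactly the envelope (`ℋ_F` vs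
`Λκ_∞(C)`, coherent with `F.Dt = Dt`) and the `μ`-part — no `(γ - 1)`-part, no rank hypothesis.
[cite: CastellaGrossiSkinner2025, Thm. 6.5.2] [cite: CastellaGrossiLeeSkinner2022, Thm. 4.1.1 proof (d(k)) and Rem. 4.1.4] -/
theorem X10.pLocalizedStabilizedContainmentTied_of_thm652_of_tower
    (h652 : CastellaGrossiSkinner2025.thm652_stabilized_rankOne_charIdeal_torsion_dvd_pLocalized.{0})
    {W : WeierstrassCurve ℚ} [W.IsElliptic] [W.IsGloballyMinimal] [NeZero (W.conductorNorm ℤ)]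
    {p : ℕ} [Fact p.Prime] {K : Type} [Field K] [NumberField K]
    (hX : ClassX10 W p) (hK : IsImaginaryQuadratic K) (h3 : NumberField.discr K ≠ -3)
    (hHN : SatisfiesHeegnerHypothesis (W.conductorNorm ℤ) K) (hHp : SatisfiesHeegnerHypothesis p K)
    (hodd : Odd (NumberField.discr K)) {κ : ZpExtension K p} (hκ : κ.IsAnticyclotomic)
    {γ : Field.absoluteGaloisGroup K} (hγ : κ.IsTopGenerator γ) {jbar : AlgebraicClosure K →+* ℂ}
    (hTw : ∀ k : ℕ, ∃ d : ℕ, ringClassSubgroup K (p ^ d) jbar ≤ κ.layerSubgroup k)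
    (Dt : ModularParametrizationData W (W.conductorNorm ℤ))
    (H : HeegnerDatum (W.conductorNorm ℤ) (NumberField.discr K)) :
    ∃ (D : (W.baseChange K).LambdaAdicSelmerData κ γ)
      (C : StabilizedHeegnerData (W.conductorNorm ℤ) W K κ jbar) (X : (W.baseChange K).SelmerDualData κ γ)
      (m : ℕ), C.Dt = Dt ∧ C.β = H.β ∧
      Ideal.span {((p : IwasawaAlgebra p) ^ m)} * stabilizedHeegnerCharIdeal D C ^ 2 ≤
        Module.charIdeal (IwasawaAlgebra p) (Submodule.torsion (IwasawaAlgebra p) X.X) := by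
  obtain ⟨D⟩ := LambdaAdicSelmerDataExists.nonempty_lambdaAdicSelmerData (W.baseChange K) p κ hγ
  obtain ⟨X⟩ := (W.baseChange K).nonempty_selmerDualData_holds κ γ hγ
  obtain ⟨C, hCDt, hCβ, -⟩ := StabilizedHeegnerData.exists_of_tower (κ := κ) (jbar := jbar) hK hHN
    hX.not_dvd_conductorNorm Dt H.dvd_sq_sub hTw
  obtain ⟨m, hm⟩ := X10.pLocalizedStabilizedContainment_of_thm652 h652 hX hK h3 hHN hHp hodd hκ hγ D C X
  exact ⟨D, C, X, m, hCDt, hCβ, hm⟩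

end Summit.BirchSwinnertonDyer.BirchSwinnertonDyer.Rank1Residual

end
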